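import Literature.MathematicalPhysics.QuantumFieldTheory.Sweep1ChatterjeeFreeEnergyProofs
import Literature.MathematicalPhysics.QuantumLattice.RepLieAlgebra
import HarnessLib

/-!
# `FreeEnergyRate` (crux `stmt-QuantumFields-22402`), line `birth`, stub `transfer`

Route `EntropyBudgetEquipartition` of `QuantumFields/YangMills`, crux
`Summit.QuantumFields.YangMills.Theses.EntropyBudgetEquipartition.FreeEnergyRate` (Chatterjee's
two-term free-energy asymptotics with a power rate, arXiv:1602.01222 Thm. 2.1 made quantitative).

The last step of the line: a two-sided power-rate bound
`|F(B_n, β) + ½(3 − 4/n + n^{−4}) D log β − K₀| ≤ β^{−κ}`, valid for all large `β` and, at each such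
`β`, for all large cube sides `n`, passes to the torus free energy density of the crux: at fixed `β`
the free-boundary cube free energies converge to `freeEnergyDensity 4 r.ρ β`
(`ChatterjeeFreeEnergy.tendsto_freeEnergyPerSite_halfOpenBox`, boundary-condition independence) and
the finite-size coefficient to `3/2` (`ChatterjeeFreeEnergy.tendsto_coeff`), so the bound survives
in the limit (`le_of_tendsto`); the crux's dimension `finrank(span{X | ∀ t, exp(tX) ∈ range r.ρ})`
is `finrank(repLieAlgebra r) = D` (`finrank_span_eq_finrank_repLieAlgebra`). No definitions, no
named facts; the YM mass gap is not touched.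
-/

noncomputable section

namespace Summit.QuantumFields.YangMills.Theorems.FreeEnergyRate

open scoped Matrix.Norms.Frobenius ENNReal NNReal
open MeasureTheory Measure Filter Topology Set
open Literature.Probability.LatticeModels Literature.MathematicalPhysics.QuantumLattice
open Literature.MathematicalPhysics.QuantumFieldTheory

/-- **Stub `transfer` of line `birth`** (from the cube rate to the torus rate, `d = 4`): if
`|F(B_n, β) + ½(3 − 4/n + n^{−4}) D log β − K₀| ≤ β^{−κ}` for all large `β` and, at each such `β`,
all large `n`, then `|f_r(β) + (3/2)·finrank(span{X | ∀ t, exp(tX) ∈ range r.ρ})·log β − K₀| ≤ 1·β^{−κ}`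
for `β ≥ β₀`: at fixed `β` the cube free energies converge to the torus density
(`ChatterjeeFreeEnergy.tendsto_freeEnergyPerSite_halfOpenBox`; `G ≅ r(G)` is second countable), the
coefficient to `3/2` (`ChatterjeeFreeEnergy.tendsto_coeff`), the bound passes to the limit
(`le_of_tendsto`), and `finrank(span …) = finrank(repLieAlgebra r) = D`
(`finrank_span_eq_finrank_repLieAlgebra`). [cite: arXiv160201222, Thm. 2.1, §17] -/
theorem stub_transfer {G : Type} [Group G] [TopologicalSpace G] [IsTopologicalGroup G]
    [CompactSpace G] [MeasurableSpace G] [BorelSpace G] (r : LatticeRep G) {D : ℕ}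
    (hD : D = Module.finrank ℝ ↥(repLieAlgebra r)) {K₀ κ : ℝ} (hκ : 0 < κ)
    (h : ∀ᶠ β : ℝ in atTop, ∀ᶠ n : ℕ in atTop,
      |freeEnergyPerSite r.ρ β (halfOpenBox 4 n) +
          (1 / 2) * ((4 : ℝ) - 1 - 4 / n + 1 / (n : ℝ) ^ 4) * (D : ℝ) * Real.log β - K₀| ≤ β ^ (-κ)) :
    ∃ K κ C β₀ : ℝ, 0 < κ ∧ ∀ β : ℝ, β₀ ≤ β →
      |freeEnergyDensity 4 r.ρ β
          + (3 * (Module.finrank ℝ ↥(Submodule.span ℝ {X : Matrix (Fin r.N) (Fin r.N) ℂ |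
                ∀ t : ℝ, NormedSpace.exp ((t : ℂ) • X) ∈ Set.range r.ρ}) : ℝ) / 2) * Real.log β
          - K| ≤ C * β ^ (-κ) := by
  -- `G ≅ r(G) ⊆ M_N(ℂ)` is second countable (the `Matrix` synonym hides the `Pi` instance)
  haveI : SecondCountableTopology (Matrix (Fin r.N) (Fin r.N) ℂ) :=
    inferInstanceAs (SecondCountableTopology (Fin r.N → Fin r.N → ℂ))
  haveI : SecondCountableTopology G :=
    (r.continuous.isClosedEmbedding r.injective).isEmbedding.secondCountableTopology
  -- the crux's dimension is `D`
  rw [finrank_span_eq_finrank_repLieAlgebra r, ← hD]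
  obtain ⟨β₀, hβ₀⟩ := Filter.eventually_atTop.1 h
  refine ⟨K₀, κ, 1, β₀, hκ, fun β hβ => ?_⟩
  rw [one_mul]
  have hev := hβ₀ β hβ
  -- at fixed `β`: the cube free energies converge to the torus density, the coefficient to `3/2`
  have h1 := ChatterjeeFreeEnergy.tendsto_freeEnergyPerSite_halfOpenBox (d := 4) r.ρ r.continuous β
  have h2 := ChatterjeeFreeEnergy.tendsto_coeff (m := 4) (by norm_num) (1 / 2 : ℝ)
    ((D : ℝ) * Real.log β)
  have h3 := ((h1.add h2).sub_const K₀).abs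
  have hlim : freeEnergyDensity 4 r.ρ β + (1 / 2 : ℝ) * (((4 : ℕ) : ℝ) - 1) * ((D : ℝ) * Real.log β) - K₀ =
      freeEnergyDensity 4 r.ρ β + 3 * (D : ℝ) / 2 * Real.log β - K₀ := by
    push_cast
    ring
  rw [hlim] at h3
  refine le_of_tendsto h3 ?_
  filter_upwards [hev] with n hn
  have e : freeEnergyPerSite r.ρ β (halfOpenBox 4 n) +
      1 / 2 * (((4 : ℕ) : ℝ) - 1 - ((4 : ℕ) : ℝ) / n + 1 / (n : ℝ) ^ 4) * ((D : ℝ) * Real.log β) - K₀ =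
      freeEnergyPerSite r.ρ β (halfOpenBox 4 n) +
        (1 / 2) * ((4 : ℝ) - 1 - 4 / n + 1 / (n : ℝ) ^ 4) * (D : ℝ) * Real.log β - K₀ := by
    push_cast
    ring
  rw [e]
  exact hn

end Summit.QuantumFields.YangMills.Theorems.FreeEnergyRate

end
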